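import Literature.Probability.Distributions.IndepProductLawDistance
import HarnessLib

/-!
# Independent products and kernels: pairing, disintegration, and swapping conditionally independent stages

Topic `Probability/Distributions`; theorems-only companion of `IndepProductLaw.lean` (`indepLaw`) and
`IndepProductLawDistance.lean`. Generic `PMF` plumbing for two-stage random experiments in which
each of `K` independent trials first draws `aⱼ ∼ μⱼ` and then `bⱼ ∼ κⱼ(aⱼ)` (e.g. the `m` runs of
the Micciancio–Regev sampling procedure, MR07 Lemma 5.7 / Thm. 5.9: offset `cᵢ`, then
`yᵢ ∼ D_{L,s,cᵢ+tᵢ}` given `cᵢ`), and for experiments where, given the first stage, two further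
stages are conditionally independent (MR07 Thm. 5.9: given `C`, the lattice vectors `Y` and the
query/answer `(A, z)` are independent, so one may condition on `(C, A, z)` and keep the product law
of `Y`):

* `PMF.bind_map_prodMk_apply` — point masses of a pairing: `(μ ⋉ κ)(a, b) = μ(a) κ_a(b)`;
* `indepLaw_bind_map_prodMk` — **disintegration of an independent product of pairings**:
  `⨂ⱼ (μⱼ ⋉ κⱼ) = (⨂ⱼ μⱼ) ⋉ (c ↦ ⨂ⱼ κⱼ(cⱼ))` (as laws on `Fin K → α × β`, the right side zipped);
* `PMF.bind_bind_map_comm` — **swapping conditionally independent stages**: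
  `c ∼ μ; y ∼ κY(c); r ∼ κR(c)` has the same law of `((c, r), y)` as `c ∼ μ; r ∼ κR(c); y ∼ κY(c)`,
  written so that the pair `(c, r)` is the first stage of a pairing with kernel `(c, r) ↦ κY(c)`;
* `indepLaw_bind_indepLaw_map` — coordinatewise two-stage processing:
  `(⨂ⱼ μⱼ) ≫= (c ↦ (⨂ⱼ νⱼ).map (h ↦ (Fⱼ(cⱼ, hⱼ))ⱼ)) = ⨂ⱼ (μⱼ ≫= (a ↦ νⱼ.map (Fⱼ a)))`.

## References

* W. Feller, *An Introduction to Probability Theory and Its Applications I*, 3rd ed., Wiley 1968,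
  Ch. V §1–2 (conditional probabilities, compound experiments) and Ch. IX §1 [folklore].
-/

noncomputable section

open scoped ENNReal

namespace PMF

variable {α β γ Ω : Type*}

/-- **Point masses of a pairing** `μ ⋉ κ := μ.bind (a ↦ (κ a).map (Prod.mk a))`:
`(μ ⋉ κ)(a, b) = μ(a) · κ_a(b)`. [folklore] -/
theorem bind_map_prodMk_apply (μ : PMF α) (κ : α → PMF β) (a : α) (b : β) :
    (μ.bind fun a => (κ a).map (Prod.mk a)) (a, b) = μ a * κ a b := by
  classical
  rw [PMF.bind_apply, tsum_eq_single a]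
  · rw [PMF.map_apply, tsum_eq_single b]
    · rw [if_pos rfl]
    · intro b' hb'
      rw [if_neg]
      exact fun h => hb' (Prod.mk.inj h).2.symm
  · intro a' ha'
    rw [PMF.map_apply, ENNReal.tsum_eq_zero.2 fun b' => ?_, mul_zero]
    rw [if_neg]
    exact fun h => ha' (Prod.mk.inj h).1.symm

/-- **Swapping conditionally independent stages.** If, given `c ∼ μ`, the variables `y ∼ κY(c)` and
`r ∼ κR(c)` are drawn independently, the law of `((c, r), y)` is the pairing of the law of `(c, r)`
with the kernel `(c, r) ↦ κY(c)` — so one may "condition on any fixed values of `c` and `r`" and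
still see `y ∼ κY(c)`. [folklore] -/
theorem bind_bind_map_comm (μ : PMF Ω) (κY : Ω → PMF β) (κR : Ω → PMF γ) :
    (μ.bind fun c => (κY c).bind fun y => (κR c).map fun r => ((c, r), y)) =
      (μ.bind fun c => (κR c).map (Prod.mk c)).bind fun cr => (κY cr.1).map (Prod.mk cr) := by
  rw [PMF.bind_bind]
  refine congrArg μ.bind (funext fun c => ?_)
  rw [PMF.bind_map]
  change ((κY c).bind fun y => (κR c).bind (PMF.pure ∘ fun r => ((c, r), y))) =
    (κR c).bind ((fun cr => (κY cr.1).bind (PMF.pure ∘ Prod.mk cr)) ∘ Prod.mk c)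
  rw [PMF.bind_comm]
  rfl

end PMF

namespace Literature.Probability.Distributions

open PMF

variable {α β : Type*}

/-- The zipping map `(c, y) ↦ (j ↦ (cⱼ, yⱼ))` hits the tuple `v` only from `(fst ∘ v, snd ∘ v)`.
[folklore] -/
theorem zip_eq_iff {K : ℕ} (c : Fin K → α) (y : Fin K → β) (v : Fin K → α × β) :
    (fun j => (c j, y j)) = v ↔ c = (fun j => (v j).1) ∧ y = fun j => (v j).2 := by
  constructor
  · rintro rfl
    exact ⟨rfl, rfl⟩
  · rintro ⟨rfl, rfl⟩
    rfl

/-- **Disintegration of an independent product of pairings**: drawing independently, for each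
`j < K`, `aⱼ ∼ μⱼ` and then `bⱼ ∼ κⱼ(aⱼ)`, gives the same law on tuples of pairs as first drawing the
whole tuple `a ∼ ⨂ⱼ μⱼ` and then, given `a`, the tuple `b ∼ ⨂ⱼ κⱼ(aⱼ)` (independent coordinates),
zipped. [folklore] -/
theorem indepLaw_bind_map_prodMk (K : ℕ) (μ : Fin K → PMF α) (κ : Fin K → α → PMF β) :
    (indepLaw K fun j => (μ j).bind fun a => (κ j a).map (Prod.mk a)) =
      (indepLaw K μ).bind fun c => (indepLaw K fun j => κ j (c j)).map fun y j => (c j, y j) := by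
  classical
  refine PMF.ext fun v => ?_
  rw [indepLaw_apply, PMF.bind_apply, tsum_eq_single (fun j => (v j).1)]
  · rw [PMF.map_apply, tsum_eq_single (fun j => (v j).2)]
    · rw [if_pos (funext fun j => rfl), indepLaw_apply, indepLaw_apply, ← Finset.prod_mul_distrib]
      exact Finset.prod_congr rfl fun j _ => bind_map_prodMk_apply _ _ _ _
    · intro y hy
      rw [if_neg]
      intro h
      exact hy ((zip_eq_iff _ _ _).1 h.symm).2
  · intro c hc
    rw [PMF.map_apply, ENNReal.tsum_eq_zero.2 fun y => ?_, mul_zero]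
    rw [if_neg]
    intro h
    exact hc ((zip_eq_iff _ _ _).1 h.symm).1

/-- The first components of `⨂ⱼ (μⱼ ⋉ κⱼ)` have law `⨂ⱼ μⱼ`. [folklore] -/
theorem indepLaw_bind_map_prodMk_map_fst (K : ℕ) (μ : Fin K → PMF α) (κ : Fin K → α → PMF β) :
    (indepLaw K fun j => (μ j).bind fun a => (κ j a).map (Prod.mk a)).map (fun v j => (v j).1) =
      indepLaw K μ := by
  rw [indepLaw_map_pi K _ (fun _ (p : α × β) => p.1)]
  refine congrArg (indepLaw K) (funext fun j => ?_)
  rw [PMF.map_bind]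
  conv_rhs => rw [← PMF.bind_pure (μ j)]
  refine congrArg (μ j).bind (funext fun a => ?_)
  rw [PMF.map_comp]
  exact PMF.map_const _ _

/-- **Coordinatewise two-stage processing of independent coordinates**: drawing `c ∼ ⨂ⱼ μⱼ`, then an
independent auxiliary tuple `h ∼ ⨂ⱼ νⱼ`, and combining coordinatewise by `Fⱼ(cⱼ, hⱼ)`, gives the
product of the per-coordinate compound laws `⨂ⱼ (μⱼ ≫= (a ↦ νⱼ.map (Fⱼ a)))` — e.g. the `m` columns
of the Micciancio–Regev query, each combined from its own offset and its own fresh uniform lattice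
class. [folklore] -/
theorem indepLaw_bind_indepLaw_map {γ : Type*} (K : ℕ) (μ : Fin K → PMF α) (ν : Fin K → PMF β)
    (F : Fin K → α → β → γ) :
    ((indepLaw K μ).bind fun c => (indepLaw K ν).map fun h j => F j (c j) (h j)) =
      indepLaw K fun j => (μ j).bind fun a => (ν j).map (F j a) := by
  have hpair : (fun j => (μ j).bind fun a => (ν j).map (F j a)) =
      fun j => ((μ j).bind fun a => (ν j).map (Prod.mk a)).map fun p => F j p.1 p.2 := by
    funext j
    rw [PMF.map_bind]
    refine congrArg (μ j).bind (funext fun a => ?_)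
    rw [PMF.map_comp]
    rfl
  rw [hpair, ← indepLaw_map_pi K _ (fun j (p : α × β) => F j p.1 p.2), indepLaw_bind_map_prodMk,
    PMF.map_bind]
  refine congrArg (indepLaw K μ).bind (funext fun c => ?_)
  rw [PMF.map_comp]
  rfl

end Literature.Probability.Distributions

end
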